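import Mathlib
import HarnessLib
import Literature.NumberTheory.Transcendental.AssociatorsBarEval

/-!
# `KernelModuloPeriodConjecture`, line `Sketch`: Newton's identity for `π_Y(φ)({m}ⁿ)`

Crux `FurushoPentagon.KernelModuloPeriodConjecture` (stmt-KontsevichZagierPeriods-15058), line
`Sketch`, registered stub `stub_newtonPiY` (stub (iii) of skeleton v8: the infinite depth-one even
family `s = (2n)` of the algebraic leaf). For a group-like solution `φ` of Drinfeld's pentagon
equation over a commutative `ℚ`-algebra `R`, Furusho's projection `π_Y(φ)` (`NCSeries.piY φ`)
satisfies the stuffle (harmonic product) relation off the corner,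
`π_Y(φ)(s) π_Y(φ)(t) = Σ_{u ∈ s ∗ t} π_Y(φ)(u)` for `s` admissible nonempty and `t` nonempty with
positive entries (tree theorem `NCSeries.DrinfeldPentagon.piY_mul_piY_eq_sum_stuffle`, Furusho 2011,
§5). Hoffman's harmonic algebra restricted to the single letter `y_m` is the algebra of symmetric
functions (`e_N = y_mᴺ = {m}ᴺ`, `p_j = y_{jm}`; Hoffman 1992, Theorem 2.2, Hoffman 1997, §2), so
`π_Y(φ)` satisfies **Newton's identity**

  `(n+1) π_Y(φ)({m}ⁿ⁺¹) = Σ_{k=0}^{n} (-1)ᵏ π_Y(φ)((k+1)m) π_Y(φ)({m}^{n-k})`  (`m ≥ 2`),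

proved here exactly as for real multiple zeta values (`multipleZeta_replicate_newton` of
`Literature/NumberTheory/Transcendental/MultipleZetaNewtonProofs.lean`, whose proof is copied with
`multipleZeta ↦ NCSeries.piY φ` and `multipleZeta_mul ↦ piY_mul_piY_eq_sum_stuffle`): the rows
`π_Y(φ)(c + km) π_Y(φ)({m}^{n-k}) = A_k + A_{k+1}` (`A_k` = the insertions of `c + km` into
`{m}^{n-k}`, the contractions of row `k` being the insertions of row `k+1`) telescope in the
alternating sum to `A_0`, and for `c = m` all `n + 1` insertions of `m` into `{m}ⁿ` are `{m}ⁿ⁺¹`.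

References: H. Furusho, *Double shuffle relation for associators*, Ann. of Math. 174 (2011), §5
[Furusho2011]; M. E. Hoffman, *Multiple harmonic series*, Pacific J. Math. 152 (1992), Thm 2.2
[Hoffman1992]; M. E. Hoffman, *The algebra of multiple harmonic series*, J. Algebra 194 (1997), §2,
Thm 4.2 [Hoffman1997]; F. Brown, *Mixed Tate motives over ℤ*, Ann. of Math. 175 (2012), §3.3
[Brown2012].
-/

namespace Summit.KontsevichZagierPeriods.FurushoPentagon.KernelModuloPeriodConjecture

open Literature.NumberTheory.Transcendental
open scoped BigOperators

/-- **The harmonic product `(c) ∗ (m, …, m)`** over any commutative ring of values: summing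
`f : List ℕ → R` over the indices of `z_c ∗ z_mᵏ` gives the `k + 1` insertions `({m}ⁱ, c, {m}^{k-i})`
plus the `k` contractions `({m}ⁱ, c + m, {m}^{k-1-i})` (Hoffman 1997, §2 rules (A1)–(A3); the
real-valued case is `MZV.sum_map_stuffle_singleton_replicate`). [cite: Hoffman1997, §2 (A1)–(A3)] -/
theorem newtonPiY_sum_map_stuffle_singleton_replicate {R : Type*} [CommRing R] (f : List ℕ → R)
    (c m : ℕ) : ∀ k : ℕ,
    ((MZV.stuffle [c] (List.replicate k m)).map f).sum =
      ∑ i ∈ Finset.range (k + 1), f (List.replicate i m ++ c :: List.replicate (k - i) m) +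
        ∑ i ∈ Finset.range k, f (List.replicate i m ++ (c + m) :: List.replicate (k - (i + 1)) m)
  | 0 => by simp
  | k + 1 => by
      rw [List.replicate_succ, MZV.stuffle_cons_cons, MZV.stuffle_nil_left, MZV.stuffle_nil_left]
      simp only [List.map_append, List.map_cons, List.map_nil, List.sum_append, List.sum_cons,
        List.sum_nil, add_zero, List.map_map]
      rw [newtonPiY_sum_map_stuffle_singleton_replicate (f ∘ List.cons m) c m k,
        Finset.sum_range_succ'
          (fun i => f (List.replicate i m ++ c :: List.replicate (k + 1 - i) m)),
        Finset.sum_range_succ'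
          (fun i => f (List.replicate i m ++ (c + m) :: List.replicate (k + 1 - (i + 1)) m))]
      simp only [Function.comp_apply, List.replicate_succ, List.cons_append, List.replicate_zero,
        List.nil_append, Nat.add_sub_add_right, Nat.sub_zero, Nat.add_sub_cancel, zero_add]
      ring

/-- **`π_Y(φ)(c) · π_Y(φ)(m, …, m)` by Furusho's stuffle off the corner** (Furusho 2011, §5, for a
group-like pentagon solution `φ` over a commutative `ℚ`-algebra; the real MZV case is Hoffman 1997,
Theorem 4.2): for `c ≥ 2`, `m ≥ 1` and every `k`,
`π_Y(φ)(c) π_Y(φ)({m}ᵏ) = Σ_{i=0}^{k} π_Y(φ)({m}ⁱ, c, {m}^{k-i}) + Σ_{i=0}^{k-1} π_Y(φ)({m}ⁱ, c+m, {m}^{k-1-i})`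
(for `k = 0` both sides are `π_Y(φ)(c)` since `π_Y(φ)(∅) = c_∅(φ) = 1`). [cite: Furusho2011, §5] -/
theorem newtonPiY_piY_singleton_mul_piY_replicate {R : Type} [CommRing R] [Algebra ℚ R]
    {φ : NCSeries Bool R} (hg : NCSeries.IsGroupLike φ) (h5 : NCSeries.DrinfeldPentagon φ)
    {c m : ℕ} (hc : 2 ≤ c) (hm : 1 ≤ m) (k : ℕ) :
    NCSeries.piY φ [c] * NCSeries.piY φ (List.replicate k m) =
      ∑ i ∈ Finset.range (k + 1),
          NCSeries.piY φ (List.replicate i m ++ c :: List.replicate (k - i) m) +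
        ∑ i ∈ Finset.range k,
          NCSeries.piY φ (List.replicate i m ++ (c + m) :: List.replicate (k - (i + 1)) m) := by
  rw [← newtonPiY_sum_map_stuffle_singleton_replicate (NCSeries.piY φ) c m k]
  rcases Nat.eq_zero_or_pos k with rfl | hk
  · simp [hg.1]
  · have hc' : MZV.IsAdmissible [c] := ⟨fun i hi => by simp at hi; omega, fun _ => hc⟩
    exact h5.piY_mul_piY_eq_sum_stuffle hg hc' (List.cons_ne_nil _ _)
      (fun i hi => by rw [List.eq_of_mem_replicate hi]; exact hm)
      (by simpa [List.replicate_eq_nil_iff] using Nat.pos_iff_ne_zero.mp hk)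

/-- **The alternating-row-sum identity for `π_Y(φ)`** (the telescoping behind Newton's identity;
Brown 2012, proof of Lemma 3.8, for real MZVs): for `c ≥ 2`, `m ≥ 1` and every `n`,
`Σ_{i=0}^{n} π_Y(φ)({m}ⁱ, c, {m}^{n-i}) = Σ_{k=0}^{n} (-1)ᵏ π_Y(φ)(c + km) π_Y(φ)({m}^{n-k})`:
the stuffle rows `π_Y(φ)(c + km) π_Y(φ)({m}^{n-k}) = A_k + A_{k+1}` (`A_k` the insertions of
`c + km` into `{m}^{n-k}`; the contractions `(c + km) + m` of row `k` are the insertions of row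
`k + 1`) telescope in the alternating sum to `A_0`. [cite: Furusho2011, §5] -/
theorem newtonPiY_sum_piY_replicate_insert {R : Type} [CommRing R] [Algebra ℚ R]
    {φ : NCSeries Bool R} (hg : NCSeries.IsGroupLike φ) (h5 : NCSeries.DrinfeldPentagon φ)
    {c m : ℕ} (hc : 2 ≤ c) (hm : 1 ≤ m) (n : ℕ) :
    ∑ i ∈ Finset.range (n + 1),
        NCSeries.piY φ (List.replicate i m ++ c :: List.replicate (n - i) m) =
      ∑ k ∈ Finset.range (n + 1), (-1) ^ k *
        (NCSeries.piY φ [c + k * m] * NCSeries.piY φ (List.replicate (n - k) m)) := by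
  -- the insertion sums `A k = ∑_{i ≤ n-k} π_Y(φ)({m}ⁱ, c + km, {m}^{n-k-i})`
  set A : ℕ → R := fun k => ∑ i ∈ Finset.range (n - k + 1),
    NCSeries.piY φ (List.replicate i m ++ (c + k * m) :: List.replicate (n - k - i) m) with hA
  have hck : ∀ k, 2 ≤ c + k * m := fun k => le_trans hc (Nat.le_add_right c _)
  -- the rows: `π_Y(c + km) π_Y({m}^{n-k}) = A k + A (k+1)` for `k < n`, `= A n` for `k = n`
  have hrow : ∀ k, k < n →
      NCSeries.piY φ [c + k * m] * NCSeries.piY φ (List.replicate (n - k) m) = A k + A (k + 1) := by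
    intro k hk
    rw [newtonPiY_piY_singleton_mul_piY_replicate hg h5 (hck k) hm (n - k)]
    simp only [hA]
    congr 1
    rw [show n - (k + 1) + 1 = n - k by omega]
    refine Finset.sum_congr rfl fun i _ => ?_
    rw [show c + k * m + m = c + (k + 1) * m by ring,
      show n - k - (i + 1) = n - (k + 1) - i by omega]
  have hlast :
      NCSeries.piY φ [c + n * m] * NCSeries.piY φ (List.replicate (n - n) m) = A n := by
    rw [newtonPiY_piY_singleton_mul_piY_replicate hg h5 (hck n) hm (n - n)]
    simp only [hA, Nat.sub_self, Finset.sum_range_zero, add_zero]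
  have hA0 : A 0 = ∑ i ∈ Finset.range (n + 1),
      NCSeries.piY φ (List.replicate i m ++ c :: List.replicate (n - i) m) := by
    simp only [hA, Nat.sub_zero, zero_mul, add_zero]
  -- telescope the alternating sum of the rows
  have htel : ∀ k, ∑ j ∈ Finset.range k, (-1 : R) ^ j * (A j + A (j + 1)) + (-1) ^ k * A k =
      A 0 := by
    intro k
    induction k with
    | zero => simp
    | succ k ih =>
      rw [Finset.sum_range_succ, pow_succ]
      linear_combination ih
  have hR : ∑ k ∈ Finset.range (n + 1), (-1 : R) ^ k *
      (NCSeries.piY φ [c + k * m] * NCSeries.piY φ (List.replicate (n - k) m)) = A 0 := by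
    rw [Finset.sum_range_succ, Finset.sum_congr rfl fun k hk => by
      rw [hrow k (Finset.mem_range.mp hk)], hlast]
    exact htel n
  rw [hR, hA0]

/-- **Stub (iii) `stub_newtonPiY` — Newton's identity in Hoffman's harmonic algebra for `π_Y(φ)`**
(`m ≥ 2`): for every group-like solution `φ` of Drinfeld's pentagon equation over a commutative
`ℚ`-algebra and every `n`,
`(n+1) π_Y(φ)({m}ⁿ⁺¹) = Σ_{k=0}^{n} (-1)ᵏ π_Y(φ)((k+1)m) π_Y(φ)({m}^{n-k})` — the Newton–Girard
formula `N e_N = Σ_{j=1}^{N} (-1)^{j-1} p_j e_{N-j}` in the harmonic algebra on the letter `y_m`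
(`e_N = y_mᴺ`, `p_j = y_{jm}`; Hoffman 1992, Theorem 2.2), evaluated at `π_Y(φ)` through Furusho's
stuffle relation off the corner (`NCSeries.DrinfeldPentagon.piY_mul_piY_eq_sum_stuffle`): the case
`c = m` of `newtonPiY_sum_piY_replicate_insert`, all `n + 1` insertions of `m` into `{m}ⁿ` being
`{m}ⁿ⁺¹`. [cite: Furusho2011, §5] -/
theorem stub_newtonPiY :
    ∀ (R : Type) [CommRing R] [Algebra ℚ R] (φ : NCSeries Bool R), NCSeries.IsGroupLike φ →
      NCSeries.DrinfeldPentagon φ → ∀ m : ℕ, 2 ≤ m → ∀ n : ℕ,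
        ((n : R) + 1) * NCSeries.piY φ (List.replicate (n + 1) m) =
          ∑ k ∈ Finset.range (n + 1),
            (-1) ^ k * (NCSeries.piY φ [(k + 1) * m] * NCSeries.piY φ (List.replicate (n - k) m)) := by
  intro R _ _ φ hg h5 m hm n
  have h := newtonPiY_sum_piY_replicate_insert hg h5 hm (le_trans one_le_two hm) n
  have hl : ∀ i ∈ Finset.range (n + 1),
      NCSeries.piY φ (List.replicate i m ++ m :: List.replicate (n - i) m) =
        NCSeries.piY φ (List.replicate (n + 1) m) := by
    intro i hi
    rw [Finset.mem_range] at hi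
    rw [← List.replicate_succ, List.replicate_append_replicate,
      show i + (n - i + 1) = n + 1 by omega]
  rw [Finset.sum_congr rfl hl, Finset.sum_const, Finset.card_range, nsmul_eq_mul] at h
  push_cast at h
  rw [h]
  refine Finset.sum_congr rfl fun k _ => ?_
  rw [show m + k * m = (k + 1) * m by ring]

end Summit.KontsevichZagierPeriods.FurushoPentagon.KernelModuloPeriodConjecture
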